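import Literature.Computability.QuantumComplexity.BlockKit
import Literature.Computability.Complexity.CodeFPBudgets
import Literature.Computability.Complexity.CodeFPLists
import HarnessLib

/-!
# The letter programs of the AJL core in polynomial time: parametric expressions and the compiler on codes

Topic `Literature/Computability/QuantumComplexity`; second step of the uniformity half of the
discharge of `ajl_jonesApproxProblem_mem_PromiseBQP` (AJL Thm. 1.2; Arora–Barak §6.2). The
classical part of every gadget of the core circuit is a straight-line program obtained by the
register compiler `SLP.AExpr.compile` / `SLP.BExpr.compile` (`RevExprCompile.lean`) from one of the
six Boolean expressions `SLP.letterPrograms k` (`LetterWord.lean`), whose leaves (`fld off len`,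
`pw i`, shifts) are *affine functions of the number `k` of averaging bits*. We introduce parametric
expressions `PA`/`PB` with affine leaves `(a, b) ↦ a·k + b` and their instances `PA.inst k`,
`PB.inst k`, and prove once and for all, by structural induction, that the compiler runs in
polynomial time on them in the typed `FP` algebra `CodeFP` (`Complexity/CodeFP.lean`):
`PB.codeFP pb : CodeFP (1ᵏ, 1ʳ, 1ᵠ) ↦ (pb.inst k).compile (4k+16) r φ` (registers and flags in
unary, instructions coded by `instrE` with the `copyIn` length in unary). The six letter programs
are instances of explicit parametric expressions (`inst_bRotPB`, `inst_bPhasePB`), whence the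
compiler outputs `(b.compile (thrWd k) 0 0)` for `b ∈ letterPrograms k`, and the layout bounds
`BlockKit.kitR/kitF/kitT k`, are computed in polynomial time from `1ᵏ` (`progsOf_codeFP`,
`kitR_codeFP`, `kitF_codeFP`, `kitT_codeFP`).

## References

* D. Aharonov, V. Jones, Z. Landau, Algorithmica 55 (2009), Thm. 1.2 and §3.3 [AharonovJonesLandau2009].
* S. Arora, B. Barak, *Computational Complexity: A Modern Approach*, CUP 2009, §1.3 and §6.2 [AroraBarak2009].
-/

noncomputable section

namespace Literature.Computability.QuantumComplexity

open _root_.Computability Complexity Complexity.CodeFP SLP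

namespace AJLCore

/-! ### Unary arithmetic on codes -/

/-- `1ᵏ ↦ 1^{a·k + b}`. [folklore] -/
theorem affUn : ∀ a b : ℕ, CodeFP unE unE (fun k => a * k + b)
  | 0, b => (const unE b).congr fun k => by simp
  | a + 1, b => (unAdd.comp ((CodeFP.id unE).pair (affUn a b))).congr fun k => by simp only [id]; ring

/-- `1ᵏ ↦ bin (a·k + b)`. [folklore] -/
theorem affNat (a b : ℕ) : CodeFP unE natE (fun k => a * k + b) := (natOfUn.comp (affUn a b)).congr fun _ => rfl

/-- Unary maximum. [folklore] -/
theorem unMax : CodeFP (pairE unE unE) unE (fun p => max p.1 p.2) :=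
  ((unMaxLen unitE unitE).comp ((replicateUnit.comp (fst _ _)).pair (replicateUnit.comp (snd _ _)))).congr fun p => by simp

/-! ### Affine leaves and parametric expressions -/

/-- An affine function `k ↦ a·k + b` of the parameter, as data. [folklore] -/
abbrev Aff : Type := ℕ × ℕ

/-- Its value. [folklore] -/
def Aff.ev (f : Aff) (k : ℕ) : ℕ := f.1 * k + f.2

/-- Parametric arithmetic expressions: `SLP.AExpr` with affine leaves. [folklore] -/
inductive PA
  /-- the input field -/
  | fld (off len : Aff)
  /-- the constant `2^i` -/
  | pw (i : Aff)
  /-- `e₁ + e₂·2^sh` -/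
  | add (e₁ e₂ : PA) (sh : Aff)
  /-- `e₁·e₂` -/
  | mul (e₁ e₂ : PA)

/-- Parametric Boolean expressions. [folklore] -/
inductive PB
  /-- `e₁ < e₂` -/
  | lt (e₁ e₂ : PA)
  /-- negation -/
  | not (b : PB)
  /-- conjunction -/
  | and (b₁ b₂ : PB)
  /-- disjunction -/
  | or (b₁ b₂ : PB)

/-- The instance of a parametric arithmetic expression at `k`. [folklore] -/
def PA.inst (k : ℕ) : PA → AExpr
  | .fld off len => .fld (off.ev k) (len.ev k)
  | .pw i => .pw (i.ev k)
  | .add e₁ e₂ sh => .add (e₁.inst k) (e₂.inst k) (sh.ev k)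
  | .mul e₁ e₂ => .mul (e₁.inst k) (e₂.inst k)

/-- The instance of a parametric Boolean expression at `k`. [folklore] -/
def PB.inst (k : ℕ) : PB → BExpr
  | .lt e₁ e₂ => .lt (e₁.inst k) (e₂.inst k)
  | .not b => .not (b.inst k)
  | .and b₁ b₂ => .and (b₁.inst k) (b₂.inst k)
  | .or b₁ b₂ => .or (b₁.inst k) (b₂.inst k)

/-! ### Codes of instructions -/

/-- The tuple of an instruction: tag, four binary fields, and the `copyIn` length (kept apart, to be
coded in unary: it bounds a loop of the layout compiler). [folklore] -/
def instrTuple : Instr → ℕ × ℕ × ℕ × ℕ × ℕ × ℕ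
  | .copyIn d off len => (0, d, off, 0, 0, len)
  | .setBit d i => (1, d, i, 0, 0, 0)
  | .add d a b sh => (2, d, a, b, sh, 0)
  | .andBit d x i y => (3, d, x, i, y, 0)
  | .lt f a b => (4, f, a, b, 0, 0)
  | .fnot f g => (5, f, g, 0, 0, 0)
  | .fand f g h => (6, f, g, h, 0, 0)
  | .forr f g h => (7, f, g, h, 0, 0)

/-- The code of an instruction tuple. [folklore] -/
abbrev tupE : ℕ × ℕ × ℕ × ℕ × ℕ × ℕ → List Bool := pairE natE (pairE natE (pairE natE (pairE natE (pairE natE unE))))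

/-- The code of an instruction. [folklore] -/
def instrE : Instr → List Bool := fun ins => tupE (instrTuple ins)

section InstrCodes

variable {α : Type} {eα : α → List Bool}

/-- Building an instruction from its tuple computed on codes. [folklore] -/
theorem instr_of_tuple {g : α → Instr} {t : α → ℕ × ℕ × ℕ × ℕ × ℕ × ℕ} (ht : CodeFP eα tupE t) (h : ∀ a, instrTuple (g a) = t a) :
    CodeFP eα instrE g := ht.recodeOut fun a => by rw [instrE]; exact congrArg tupE (h a).symm

/-- `copyIn` on codes: `(bin d, bin off, 1^len)`. [folklore] -/
theorem instr_copyIn {d off len : α → ℕ} (hd : CodeFP eα natE d) (ho : CodeFP eα natE off) (hl : CodeFP eα unE len) :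
    CodeFP eα instrE (fun a => Instr.copyIn (d a) (off a) (len a)) :=
  instr_of_tuple ((const eα 0).pair (hd.pair (ho.pair ((const eα 0).pair ((const eα 0).pair hl))))) fun _ => rfl

/-- `setBit` on codes. [folklore] -/
theorem instr_setBit {d i : α → ℕ} (hd : CodeFP eα natE d) (hi : CodeFP eα natE i) :
    CodeFP eα instrE (fun a => Instr.setBit (d a) (i a)) :=
  instr_of_tuple ((const eα 1).pair (hd.pair (hi.pair ((const eα 0).pair ((const eα 0).pair (const eα 0)))))) fun _ => rfl

/-- `add` on codes. [folklore] -/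
theorem instr_add {d x y sh : α → ℕ} (hd : CodeFP eα natE d) (hx : CodeFP eα natE x) (hy : CodeFP eα natE y) (hsh : CodeFP eα natE sh) :
    CodeFP eα instrE (fun a => Instr.add (d a) (x a) (y a) (sh a)) :=
  instr_of_tuple ((const eα 2).pair (hd.pair (hx.pair (hy.pair (hsh.pair (const eα 0)))))) fun _ => rfl

/-- `andBit` on codes. [folklore] -/
theorem instr_andBit {d x i y : α → ℕ} (hd : CodeFP eα natE d) (hx : CodeFP eα natE x) (hi : CodeFP eα natE i) (hy : CodeFP eα natE y) :
    CodeFP eα instrE (fun a => Instr.andBit (d a) (x a) (i a) (y a)) :=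
  instr_of_tuple ((const eα 3).pair (hd.pair (hx.pair (hi.pair (hy.pair (const eα 0)))))) fun _ => rfl

/-- `lt` on codes. [folklore] -/
theorem instr_lt {f x y : α → ℕ} (hf : CodeFP eα natE f) (hx : CodeFP eα natE x) (hy : CodeFP eα natE y) :
    CodeFP eα instrE (fun a => Instr.lt (f a) (x a) (y a)) :=
  instr_of_tuple ((const eα 4).pair (hf.pair (hx.pair (hy.pair ((const eα 0).pair (const eα 0)))))) fun _ => rfl

/-- `fnot` on codes. [folklore] -/
theorem instr_fnot {f g : α → ℕ} (hf : CodeFP eα natE f) (hg : CodeFP eα natE g) :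
    CodeFP eα instrE (fun a => Instr.fnot (f a) (g a)) :=
  instr_of_tuple ((const eα 5).pair (hf.pair (hg.pair ((const eα 0).pair ((const eα 0).pair (const eα 0)))))) fun _ => rfl

/-- `fand` on codes. [folklore] -/
theorem instr_fand {f g h : α → ℕ} (hf : CodeFP eα natE f) (hg : CodeFP eα natE g) (hh : CodeFP eα natE h) :
    CodeFP eα instrE (fun a => Instr.fand (f a) (g a) (h a)) :=
  instr_of_tuple ((const eα 6).pair (hf.pair (hg.pair (hh.pair ((const eα 0).pair (const eα 0)))))) fun _ => rfl

/-- `forr` on codes. [folklore] -/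
theorem instr_forr {f g h : α → ℕ} (hf : CodeFP eα natE f) (hg : CodeFP eα natE g) (hh : CodeFP eα natE h) :
    CodeFP eα instrE (fun a => Instr.forr (f a) (g a) (h a)) :=
  instr_of_tuple ((const eα 7).pair (hf.pair (hg.pair (hh.pair ((const eα 0).pair (const eα 0)))))) fun _ => rfl

end InstrCodes

/-! ### The multiplication macro on codes -/

/-- The multiplication macro as a map over the rows. [folklore] -/
theorem mulInstrsUpTo_eq (r₀ x y : ℕ) : ∀ i : ℕ, mulInstrsUpTo r₀ x y i =
    ((List.range i).map fun j => [Instr.andBit (r₀ + 2 * j + 1) x j y, Instr.add (r₀ + 2 * j + 2) (r₀ + 2 * j) (r₀ + 2 * j + 1) j]).flatten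
  | 0 => rfl
  | i + 1 => by
    rw [mulInstrsUpTo, mulInstrsUpTo_eq r₀ x y i, List.range_succ, List.map_append, List.flatten_append, List.map_singleton, List.flatten_singleton]

/-- The input code of the arithmetic compiler: `(1ᵏ, 1ʳ)`. [folklore] -/
abbrev inAE : ℕ × ℕ → List Bool := pairE unE unE

/-- The output code of the arithmetic compiler: `(program, 1^{result}, 1^{next})`. [folklore] -/
abbrev outAE : List Instr × ℕ × ℕ → List Bool := pairE (rawE instrE) (pairE unE unE)

/-- **The multiplication macro on codes**: `(1ᵏ, bin r₀, bin x, bin y) ↦ mulInstrs (4k+16) r₀ x y`. [folklore] -/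
theorem mulInstrs_codeFP : CodeFP (pairE unE (pairE natE (pairE natE natE))) (rawE instrE) (fun t => mulInstrs (thrWd t.1) t.2.1 t.2.2.1 t.2.2.2) := by
  -- context: the whole input; items: the rows `j < Wd`
  let σE : (ℕ × ℕ × ℕ × ℕ) × ℕ → List Bool := pairE (pairE unE (pairE natE (pairE natE natE))) natE
  have hr : CodeFP σE natE (fun t => t.1.2.1) := ((fst _ _).snd'.fst' :)
  have hx : CodeFP σE natE (fun t => t.1.2.2.1) := ((fst _ _).snd'.snd'.fst' :)
  have hy : CodeFP σE natE (fun t => t.1.2.2.2) := ((fst _ _).snd'.snd'.snd' :)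
  have hj : CodeFP σE natE (fun t => t.2) := (snd _ _ :)
  have h2j : CodeFP σE natE (fun t => t.1.2.1 + 2 * t.2) := (natAdd.comp (hr.pair (natMul.comp ((const _ 2).pair hj))) :)
  have h2j1 : CodeFP σE natE (fun t => t.1.2.1 + 2 * t.2 + 1) := (natAdd.comp (h2j.pair (const _ 1)) :)
  have h2j2 : CodeFP σE natE (fun t => t.1.2.1 + 2 * t.2 + 2) := (natAdd.comp (h2j.pair (const _ 2)) :)
  have hA : CodeFP σE instrE (fun t => Instr.andBit (t.1.2.1 + 2 * t.2 + 1) t.1.2.2.1 t.2 t.1.2.2.2) := (instr_andBit h2j1 hx hj hy :)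
  have hB : CodeFP σE (rawE instrE) (fun t => [Instr.add (t.1.2.1 + 2 * t.2 + 2) (t.1.2.1 + 2 * t.2) (t.1.2.1 + 2 * t.2 + 1) t.2]) := (
    (rawSingleton instrE).comp (instr_add h2j2 h2j h2j1 hj) :)
  have hrow : CodeFP σE (rawE instrE) (fun t => [Instr.andBit (t.1.2.1 + 2 * t.2 + 1) t.1.2.2.1 t.2 t.1.2.2.2,
      Instr.add (t.1.2.1 + 2 * t.2 + 2) (t.1.2.1 + 2 * t.2) (t.1.2.1 + 2 * t.2 + 1) t.2]) := ((rawCons instrE).comp (hA.pair hB) :)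
  have hW : CodeFP (pairE unE (pairE natE (pairE natE natE))) (rawE natE) (fun t => List.range (thrWd t.1)) :=
    (urange.comp ((affUn 4 16).comp (fst _ _))).congr fun t => by simp [thrWd]
  refine (((flatten instrE).comp ((map hrow).comp ((CodeFP.id _).pair hW))).congr fun t => ?_)
  rw [mulInstrs, mulInstrsUpTo_eq]; rfl

/-! ### The compiler on parametric expressions -/

/-- **The arithmetic compiler in polynomial time**: `(1ᵏ, 1ʳ) ↦ (pe.inst k).compile (4k+16) r`. [cite: AroraBarak2009, §1.3] -/
theorem PA.codeFP : ∀ pe : PA, CodeFP inAE outAE (fun t => (pe.inst t.1).compile (thrWd t.1) t.2)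
  | .fld off len => by
    have h : CodeFP inAE outAE (fun t => ([Instr.copyIn t.2 (off.ev t.1) (len.ev t.1)], t.2, t.2 + 1)) := (
      ((rawSingleton instrE).comp (instr_copyIn (natOfUn.comp (snd _ _)) ((affNat off.1 off.2).comp (fst _ _)) ((affUn len.1 len.2).comp (fst _ _)))).pair
        ((snd _ _).pair (unSucc.comp (snd _ _))) :)
    exact h.congr fun t => rfl
  | .pw i => by
    have h : CodeFP inAE outAE (fun t => ([Instr.setBit t.2 (i.ev t.1)], t.2, t.2 + 1)) := (
      ((rawSingleton instrE).comp (instr_setBit (natOfUn.comp (snd _ _)) ((affNat i.1 i.2).comp (fst _ _)))).pair ((snd _ _).pair (unSucc.comp (snd _ _))) :)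
    exact h.congr fun t => rfl
  | .add e₁ e₂ sh => by
    have H1 : CodeFP inAE outAE (fun t => (e₁.inst t.1).compile (thrWd t.1) t.2) := (PA.codeFP e₁ :)
    have H2 : CodeFP inAE outAE (fun t => (e₂.inst t.1).compile (thrWd t.1) ((e₁.inst t.1).compile (thrWd t.1) t.2).2.2) := (
      (PA.codeFP e₂).comp ((fst _ _).pair H1.snd'.snd') :)
    have h : CodeFP inAE outAE (fun t =>
        (((e₁.inst t.1).compile (thrWd t.1) t.2).1 ++ ((e₂.inst t.1).compile (thrWd t.1) ((e₁.inst t.1).compile (thrWd t.1) t.2).2.2).1 ++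
          [Instr.add ((e₂.inst t.1).compile (thrWd t.1) ((e₁.inst t.1).compile (thrWd t.1) t.2).2.2).2.2 ((e₁.inst t.1).compile (thrWd t.1) t.2).2.1
            ((e₂.inst t.1).compile (thrWd t.1) ((e₁.inst t.1).compile (thrWd t.1) t.2).2.2).2.1 (sh.ev t.1)],
        ((e₂.inst t.1).compile (thrWd t.1) ((e₁.inst t.1).compile (thrWd t.1) t.2).2.2).2.2,
        ((e₂.inst t.1).compile (thrWd t.1) ((e₁.inst t.1).compile (thrWd t.1) t.2).2.2).2.2 + 1)) := (
      ((rawAppend instrE).comp (((rawAppend instrE).comp (H1.fst'.pair H2.fst')).pair ((rawSingleton instrE).comp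
        (instr_add (natOfUn.comp H2.snd'.snd') (natOfUn.comp H1.snd'.fst') (natOfUn.comp H2.snd'.fst') ((affNat sh.1 sh.2).comp (fst _ _)))))).pair
        (H2.snd'.snd'.pair (unSucc.comp H2.snd'.snd')) :)
    exact h.congr fun t => rfl
  | .mul e₁ e₂ => by
    have H1 : CodeFP inAE outAE (fun t => (e₁.inst t.1).compile (thrWd t.1) t.2) := (PA.codeFP e₁ :)
    have H2 : CodeFP inAE outAE (fun t => (e₂.inst t.1).compile (thrWd t.1) ((e₁.inst t.1).compile (thrWd t.1) t.2).2.2) := (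
      (PA.codeFP e₂).comp ((fst _ _).pair H1.snd'.snd') :)
    have hW : CodeFP inAE unE (fun t => 2 * thrWd t.1) := ((affUn 8 32).comp (fst _ _)).congr fun t => by simp [thrWd]; ring
    have h : CodeFP inAE outAE (fun t =>
        (((e₁.inst t.1).compile (thrWd t.1) t.2).1 ++ ((e₂.inst t.1).compile (thrWd t.1) ((e₁.inst t.1).compile (thrWd t.1) t.2).2.2).1 ++
          mulInstrs (thrWd t.1) ((e₂.inst t.1).compile (thrWd t.1) ((e₁.inst t.1).compile (thrWd t.1) t.2).2.2).2.2 ((e₁.inst t.1).compile (thrWd t.1) t.2).2.1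
            ((e₂.inst t.1).compile (thrWd t.1) ((e₁.inst t.1).compile (thrWd t.1) t.2).2.2).2.1,
        ((e₂.inst t.1).compile (thrWd t.1) ((e₁.inst t.1).compile (thrWd t.1) t.2).2.2).2.2 + 2 * thrWd t.1,
        ((e₂.inst t.1).compile (thrWd t.1) ((e₁.inst t.1).compile (thrWd t.1) t.2).2.2).2.2 + 2 * thrWd t.1 + 1)) := (
      ((rawAppend instrE).comp (((rawAppend instrE).comp (H1.fst'.pair H2.fst')).pair
        (mulInstrs_codeFP.comp ((fst _ _).pair ((natOfUn.comp H2.snd'.snd').pair ((natOfUn.comp H1.snd'.fst').pair (natOfUn.comp H2.snd'.fst'))))))).pair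
        ((unAdd.comp (H2.snd'.snd'.pair hW)).pair (unSucc.comp (unAdd.comp (H2.snd'.snd'.pair hW)))) :)
    exact h.congr fun t => rfl

/-- The input code of the Boolean compiler: `(1ᵏ, 1ʳ, 1ᵠ)`. [folklore] -/
abbrev inBE : ℕ × ℕ × ℕ → List Bool := pairE unE (pairE unE unE)

/-- The output code of the Boolean compiler: `(program, 1^{flag}, 1^{next register}, 1^{next flag})`. [folklore] -/
abbrev outBE : List Instr × ℕ × ℕ × ℕ → List Bool := pairE (rawE instrE) (pairE unE (pairE unE unE))

/-- **The Boolean compiler in polynomial time**: `(1ᵏ, 1ʳ, 1ᵠ) ↦ (pb.inst k).compile (4k+16) r φ`. [cite: AroraBarak2009, §1.3] -/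
theorem PB.codeFP : ∀ pb : PB, CodeFP inBE outBE (fun t => (pb.inst t.1).compile (thrWd t.1) t.2.1 t.2.2)
  | .lt e₁ e₂ => by
    have H1 : CodeFP inBE outAE (fun t => (e₁.inst t.1).compile (thrWd t.1) t.2.1) := ((PA.codeFP e₁).comp ((fst _ _).pair (snd _ _).fst') :)
    have H2 : CodeFP inBE outAE (fun t => (e₂.inst t.1).compile (thrWd t.1) ((e₁.inst t.1).compile (thrWd t.1) t.2.1).2.2) := (
      (PA.codeFP e₂).comp ((fst _ _).pair H1.snd'.snd') :)
    have hφ : CodeFP inBE unE (fun t => t.2.2) := ((snd _ _).snd' :)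
    have h : CodeFP inBE outBE (fun t =>
        (((e₁.inst t.1).compile (thrWd t.1) t.2.1).1 ++ ((e₂.inst t.1).compile (thrWd t.1) ((e₁.inst t.1).compile (thrWd t.1) t.2.1).2.2).1 ++
          [Instr.lt t.2.2 ((e₁.inst t.1).compile (thrWd t.1) t.2.1).2.1 ((e₂.inst t.1).compile (thrWd t.1) ((e₁.inst t.1).compile (thrWd t.1) t.2.1).2.2).2.1],
        t.2.2, ((e₂.inst t.1).compile (thrWd t.1) ((e₁.inst t.1).compile (thrWd t.1) t.2.1).2.2).2.2, t.2.2 + 1)) := (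
      ((rawAppend instrE).comp (((rawAppend instrE).comp (H1.fst'.pair H2.fst')).pair ((rawSingleton instrE).comp
        (instr_lt (natOfUn.comp hφ) (natOfUn.comp H1.snd'.fst') (natOfUn.comp H2.snd'.fst'))))).pair (hφ.pair (H2.snd'.snd'.pair (unSucc.comp hφ))) :)
    exact h.congr fun t => rfl
  | .not b => by
    have H : CodeFP inBE outBE (fun t => (b.inst t.1).compile (thrWd t.1) t.2.1 t.2.2) := (PB.codeFP b :)
    have h : CodeFP inBE outBE (fun t =>
        (((b.inst t.1).compile (thrWd t.1) t.2.1 t.2.2).1 ++ [Instr.fnot ((b.inst t.1).compile (thrWd t.1) t.2.1 t.2.2).2.2.2 ((b.inst t.1).compile (thrWd t.1) t.2.1 t.2.2).2.1],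
        ((b.inst t.1).compile (thrWd t.1) t.2.1 t.2.2).2.2.2, ((b.inst t.1).compile (thrWd t.1) t.2.1 t.2.2).2.2.1, ((b.inst t.1).compile (thrWd t.1) t.2.1 t.2.2).2.2.2 + 1)) := (
      ((rawAppend instrE).comp (H.fst'.pair ((rawSingleton instrE).comp (instr_fnot (natOfUn.comp H.snd'.snd'.snd') (natOfUn.comp H.snd'.fst'))))).pair
        (H.snd'.snd'.snd'.pair (H.snd'.snd'.fst'.pair (unSucc.comp H.snd'.snd'.snd'))) :)
    exact h.congr fun t => rfl
  | .and b₁ b₂ => by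
    have H1 : CodeFP inBE outBE (fun t => (b₁.inst t.1).compile (thrWd t.1) t.2.1 t.2.2) := (PB.codeFP b₁ :)
    have H2 : CodeFP inBE outBE (fun t => (b₂.inst t.1).compile (thrWd t.1) ((b₁.inst t.1).compile (thrWd t.1) t.2.1 t.2.2).2.2.1 ((b₁.inst t.1).compile (thrWd t.1) t.2.1 t.2.2).2.2.2) := (
      (PB.codeFP b₂).comp ((fst _ _).pair (H1.snd'.snd'.fst'.pair H1.snd'.snd'.snd')) :)
    have h : CodeFP inBE outBE (fun t =>
        (((b₁.inst t.1).compile (thrWd t.1) t.2.1 t.2.2).1 ++ ((b₂.inst t.1).compile (thrWd t.1) ((b₁.inst t.1).compile (thrWd t.1) t.2.1 t.2.2).2.2.1 ((b₁.inst t.1).compile (thrWd t.1) t.2.1 t.2.2).2.2.2).1 ++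
          [Instr.fand ((b₂.inst t.1).compile (thrWd t.1) ((b₁.inst t.1).compile (thrWd t.1) t.2.1 t.2.2).2.2.1 ((b₁.inst t.1).compile (thrWd t.1) t.2.1 t.2.2).2.2.2).2.2.2
            ((b₁.inst t.1).compile (thrWd t.1) t.2.1 t.2.2).2.1 ((b₂.inst t.1).compile (thrWd t.1) ((b₁.inst t.1).compile (thrWd t.1) t.2.1 t.2.2).2.2.1 ((b₁.inst t.1).compile (thrWd t.1) t.2.1 t.2.2).2.2.2).2.1],
        ((b₂.inst t.1).compile (thrWd t.1) ((b₁.inst t.1).compile (thrWd t.1) t.2.1 t.2.2).2.2.1 ((b₁.inst t.1).compile (thrWd t.1) t.2.1 t.2.2).2.2.2).2.2.2,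
        ((b₂.inst t.1).compile (thrWd t.1) ((b₁.inst t.1).compile (thrWd t.1) t.2.1 t.2.2).2.2.1 ((b₁.inst t.1).compile (thrWd t.1) t.2.1 t.2.2).2.2.2).2.2.1,
        ((b₂.inst t.1).compile (thrWd t.1) ((b₁.inst t.1).compile (thrWd t.1) t.2.1 t.2.2).2.2.1 ((b₁.inst t.1).compile (thrWd t.1) t.2.1 t.2.2).2.2.2).2.2.2 + 1)) := (
      ((rawAppend instrE).comp (((rawAppend instrE).comp (H1.fst'.pair H2.fst')).pair ((rawSingleton instrE).comp
        (instr_fand (natOfUn.comp H2.snd'.snd'.snd') (natOfUn.comp H1.snd'.fst') (natOfUn.comp H2.snd'.fst'))))).pair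
        (H2.snd'.snd'.snd'.pair (H2.snd'.snd'.fst'.pair (unSucc.comp H2.snd'.snd'.snd'))) :)
    exact h.congr fun t => rfl
  | .or b₁ b₂ => by
    have H1 : CodeFP inBE outBE (fun t => (b₁.inst t.1).compile (thrWd t.1) t.2.1 t.2.2) := (PB.codeFP b₁ :)
    have H2 : CodeFP inBE outBE (fun t => (b₂.inst t.1).compile (thrWd t.1) ((b₁.inst t.1).compile (thrWd t.1) t.2.1 t.2.2).2.2.1 ((b₁.inst t.1).compile (thrWd t.1) t.2.1 t.2.2).2.2.2) := (
      (PB.codeFP b₂).comp ((fst _ _).pair (H1.snd'.snd'.fst'.pair H1.snd'.snd'.snd')) :)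
    have h : CodeFP inBE outBE (fun t =>
        (((b₁.inst t.1).compile (thrWd t.1) t.2.1 t.2.2).1 ++ ((b₂.inst t.1).compile (thrWd t.1) ((b₁.inst t.1).compile (thrWd t.1) t.2.1 t.2.2).2.2.1 ((b₁.inst t.1).compile (thrWd t.1) t.2.1 t.2.2).2.2.2).1 ++
          [Instr.forr ((b₂.inst t.1).compile (thrWd t.1) ((b₁.inst t.1).compile (thrWd t.1) t.2.1 t.2.2).2.2.1 ((b₁.inst t.1).compile (thrWd t.1) t.2.1 t.2.2).2.2.2).2.2.2
            ((b₁.inst t.1).compile (thrWd t.1) t.2.1 t.2.2).2.1 ((b₂.inst t.1).compile (thrWd t.1) ((b₁.inst t.1).compile (thrWd t.1) t.2.1 t.2.2).2.2.1 ((b₁.inst t.1).compile (thrWd t.1) t.2.1 t.2.2).2.2.2).2.1],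
        ((b₂.inst t.1).compile (thrWd t.1) ((b₁.inst t.1).compile (thrWd t.1) t.2.1 t.2.2).2.2.1 ((b₁.inst t.1).compile (thrWd t.1) t.2.1 t.2.2).2.2.2).2.2.2,
        ((b₂.inst t.1).compile (thrWd t.1) ((b₁.inst t.1).compile (thrWd t.1) t.2.1 t.2.2).2.2.1 ((b₁.inst t.1).compile (thrWd t.1) t.2.1 t.2.2).2.2.2).2.2.1,
        ((b₂.inst t.1).compile (thrWd t.1) ((b₁.inst t.1).compile (thrWd t.1) t.2.1 t.2.2).2.2.1 ((b₁.inst t.1).compile (thrWd t.1) t.2.1 t.2.2).2.2.2).2.2.2 + 1)) := (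
      ((rawAppend instrE).comp (((rawAppend instrE).comp (H1.fst'.pair H2.fst')).pair ((rawSingleton instrE).comp
        (instr_forr (natOfUn.comp H2.snd'.snd'.snd') (natOfUn.comp H1.snd'.fst') (natOfUn.comp H2.snd'.fst'))))).pair
        (H2.snd'.snd'.snd'.pair (H2.snd'.snd'.fst'.pair (unSucc.comp H2.snd'.snd'.snd'))) :)
    exact h.congr fun t => rfl

/-! ### The letter programs as parametric expressions -/

section Mirrors

/-- `0`. [folklore] -/
def zeroPA : PA := .fld (0, 0) (0, 0)
/-- `e · 2^s`. [folklore] -/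
def shlPA (e : PA) (s : Aff) : PA := .add zeroPA e s
/-- the averaging field `a`. [folklore] -/
def aPA : PA := .fld (0, 0) (1, 0)
/-- `a·a`. [folklore] -/
def aaPA : PA := .mul aPA aPA
/-- the bit at an affine offset. [folklore] -/
def bitPB (off : Aff) : PB := .lt zeroPA (.fld off (0, 1))
/-- `T₀`. [folklore] -/
def thr0PB : PB := .lt (shlPA aPA (0, 1)) (.pw (1, 0))
/-- `T₁`. [folklore] -/
def thr1PB : PB :=
  .and (.lt (shlPA aPA (0, 2)) (.add (.pw (1, 0)) (.pw (1, 0)) (0, 1)))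
    (.lt (.add (shlPA aPA (1, 1)) aPA (1, 2)) (.add (.pw (2, 0)) aaPA (0, 2)))
/-- `P`. [folklore] -/
def pPA : PA := .add (.add (.pw (2, 0)) (.pw (2, 0)) (0, 1)) aaPA (0, 3)
/-- `Q`. [folklore] -/
def qPA : PA := shlPA aPA (1, 3)
/-- `T₂`. [folklore] -/
def thr2PB : PB :=
  .and thr0PB (.lt (.add (.add (.pw (4, 0)) (.pw (4, 0)) (0, 2)) (.mul pPA qPA) (0, 1)) (.add (.mul pPA pPA) (.mul qPA qPA) (0, 0)))
/-- `T₄`. [folklore] -/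
def thr4PB : PB :=
  .or (.lt (shlPA aPA (0, 3)) (.add (.pw (1, 0)) (.pw (1, 0)) (0, 1)))
    (.lt (.add (shlPA aaPA (0, 4)) (.pw (2, 0)) (0, 0)) (.add (shlPA aPA (1, 2)) aPA (1, 3)))
/-- `P''`. [folklore] -/
def p2PA : PA := .add (.add (.pw (2, 1)) (.pw (2, 2)) (0, 0)) aaPA (0, 6)
/-- `Q''`. [folklore] -/
def q2PA : PA := shlPA aPA (1, 6)
/-- `T₅`. [folklore] -/
def thr5PB : PB :=
  .and thr0PB (.and (.lt q2PA p2PA)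
    (.lt (.add (.add (.pw (4, 2)) (.pw (4, 4)) (0, 0)) (.mul p2PA q2PA) (0, 1)) (.add (.mul p2PA p2PA) (.mul q2PA q2PA) (0, 0))))
/-- `if c then x else y`. [folklore] -/
def itePB (c x y : PB) : PB := .or (.and c x) (.and (.not c) y)
/-- `true` at an affine offset. [folklore] -/
def truePB (f : Aff) : PB := .or (bitPB f) (.not (bitPB f))
/-- the rotation sign predicate. [folklore] -/
def rotSignPB (ctl pd p10 p01 : PB) : PB :=
  itePB ctl (itePB (bitPB (1, 0)) (itePB (bitPB (1, 1)) p01 p10) pd) (itePB (bitPB (1, 0)) thr0PB (truePB (1, 0)))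
/-- the phase sign predicate. [folklore] -/
def phaseSignPB (ctl pre pim : PB) : PB := itePB ctl (itePB (bitPB (1, 0)) pim pre) (itePB (bitPB (1, 0)) thr0PB (truePB (1, 0)))
/-- a literal at an affine offset. [folklore] -/
def litPB (f : Aff) (v : Bool) : PB := if v then bitPB f else .not (bitPB f)
/-- conjunction of literals from offset `k + c`. [folklore] -/
def conjPB : ℕ → List Bool → PB
  | _, [] => truePB (0, 0)
  | c, [v] => litPB (1, c) v
  | c, v :: w :: vs => .and (litPB (1, c) v) (conjPB (c + 1) (w :: vs))
/-- the rotation control. [folklore] -/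
def ctlRotPB (z : ℤ) : PB := conjPB 2 (if z = 2 then [true, true, false, true, false, false, true] else [true, true, true, false, true, true, false])
/-- the phase control. [folklore] -/
def ctlPhasePB : PB :=
  .and (conjPB 2 [true, true])
    (.or (.or (conjPB 4 [false, false, false, true, false, false]) (conjPB 4 [false, true, false, false, false, true]))
      (.or (conjPB 4 [true, false, false, true, true, false]) (conjPB 4 [true, true, true, false, true, true])))
/-- **The parametric rotation program.** [folklore] -/
def bRotPB (z sgn : ℤ) : PB :=
  if z = 2 then
    (if sgn = 1 then rotSignPB (ctlRotPB 2) (.not thr1PB) (.not thr2PB) thr2PB else rotSignPB (ctlRotPB 2) (.not thr1PB) thr2PB (.not thr2PB))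
  else
    (if sgn = 1 then rotSignPB (ctlRotPB 3) (.not thr2PB) (.not thr1PB) thr1PB else rotSignPB (ctlRotPB 3) (.not thr2PB) thr1PB (.not thr1PB))
/-- **The parametric phase program.** [folklore] -/
def bPhasePB (pos : Bool) : PB := phaseSignPB ctlPhasePB (.not thr4PB) (if pos then .not thr5PB else thr5PB)

variable (k : ℕ)

/-- Values of affine leaves. [folklore] -/
theorem Aff.ev_mk (a b : ℕ) : Aff.ev (a, b) k = a * k + b := rfl

attribute [local simp] PA.inst PB.inst Aff.ev_mk Nat.zero_mul Nat.one_mul Nat.zero_add Nat.add_zero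

/-- [folklore] -/ @[simp] theorem inst_zeroPA : zeroPA.inst k = zeroE := by simp [zeroPA, zeroE]
/-- [folklore] -/ @[simp] theorem inst_aPA : aPA.inst k = aE k := by simp [aPA, aE]
/-- [folklore] -/ @[simp] theorem inst_shlPA (e : PA) (s : Aff) : (shlPA e s).inst k = shlE (e.inst k) (s.ev k) := by simp [shlPA, shlE]
/-- [folklore] -/ @[simp] theorem inst_aaPA : aaPA.inst k = .mul (aE k) (aE k) := by simp [aaPA]
/-- [folklore] -/ @[simp] theorem inst_bitPB (f : Aff) : (bitPB f).inst k = bitB (f.ev k) := by simp [bitPB, bitB]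
/-- [folklore] -/ @[simp] theorem inst_thr0PB : thr0PB.inst k = thr0B k := by simp [thr0PB, thr0B]
/-- [folklore] -/ @[simp] theorem inst_thr1PB : thr1PB.inst k = thr1B k := by simp [thr1PB, thr1B]
/-- [folklore] -/ @[simp] theorem inst_pPA : pPA.inst k = pE k := by simp [pPA, pE]
/-- [folklore] -/ @[simp] theorem inst_qPA : qPA.inst k = qE k := by simp [qPA, qE]
/-- [folklore] -/ @[simp] theorem inst_thr2PB : thr2PB.inst k = thr2B k := by simp [thr2PB, thr2B]
/-- [folklore] -/ @[simp] theorem inst_thr4PB : thr4PB.inst k = thr4B k := by simp [thr4PB, thr4B]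
/-- [folklore] -/ @[simp] theorem inst_p2PA : p2PA.inst k = p''E k := by simp [p2PA, p''E]
/-- [folklore] -/ @[simp] theorem inst_q2PA : q2PA.inst k = q''E k := by simp [q2PA, q''E]
/-- [folklore] -/ @[simp] theorem inst_thr5PB : thr5PB.inst k = thr5B k := by simp [thr5PB, thr5B]
/-- [folklore] -/ @[simp] theorem inst_itePB (c x y : PB) : (itePB c x y).inst k = iteB (c.inst k) (x.inst k) (y.inst k) := by simp [itePB, iteB]
/-- [folklore] -/ @[simp] theorem inst_truePB (f : Aff) : (truePB f).inst k = trueB (f.ev k) := by simp [truePB, trueB]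
/-- [folklore] -/ @[simp] theorem inst_rotSignPB (ctl pd p10 p01 : PB) :
    (rotSignPB ctl pd p10 p01).inst k = rotSignB k (ctl.inst k) (pd.inst k) (p10.inst k) (p01.inst k) := by simp [rotSignPB, rotSignB]
/-- [folklore] -/ @[simp] theorem inst_phaseSignPB (ctl pre pim : PB) :
    (phaseSignPB ctl pre pim).inst k = phaseSignB k (ctl.inst k) (pre.inst k) (pim.inst k) := by simp [phaseSignPB, phaseSignB]
/-- [folklore] -/ @[simp] theorem inst_litPB (f : Aff) (v : Bool) : (litPB f v).inst k = litB (f.ev k) v := by cases v <;> simp [litPB, litB]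
/-- [folklore] -/ @[simp] theorem inst_conjPB : ∀ (c : ℕ) (vs : List Bool), (conjPB c vs).inst k = conjB (k + c) vs
  | c, [] => by simp [conjPB, conjB]
  | c, [v] => by simp [conjPB, conjB]
  | c, v :: w :: vs => by
    rw [conjPB, conjB, PB.inst, inst_litPB, inst_conjPB (c + 1) (w :: vs), show Aff.ev (1, c) k = k + c by simp]; rfl
/-- [folklore] -/ @[simp] theorem inst_ctlRotPB (z : ℤ) : (ctlRotPB z).inst k = ctlRotB k z := by
  unfold ctlRotPB ctlRotB; split_ifs <;> simp
/-- [folklore] -/ @[simp] theorem inst_ctlPhasePB : ctlPhasePB.inst k = ctlPhaseB k := by simp [ctlPhasePB, ctlPhaseB]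
/-- **The parametric rotation program is the rotation program.** [folklore] -/
@[simp] theorem inst_bRotPB (z sgn : ℤ) : (bRotPB z sgn).inst k = bRot k z sgn := by
  unfold bRotPB bRot; split_ifs <;> simp
/-- **The parametric phase program is the phase program.** [folklore] -/
@[simp] theorem inst_bPhasePB (pos : Bool) : (bPhasePB pos).inst k = bPhase k pos := by
  cases pos <;> simp [bPhasePB, bPhase]

end Mirrors

/-! ### The compiler outputs and the layout bounds in polynomial time -/

/-- The parametric letter programs, in the order of `SLP.letterPrograms`. [folklore] -/
def letterPBs : List PB := [bRotPB 2 1, bRotPB 2 (-1), bRotPB 3 1, bRotPB 3 (-1), bPhasePB true, bPhasePB false]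

/-- Their instances are the letter programs. [folklore] -/
theorem letterPBs_inst (k : ℕ) : letterPBs.map (PB.inst k) = letterPrograms k := by
  simp [letterPBs, letterPrograms]

/-- The compiler outputs of the letter programs. [folklore] -/
def progsOf (k : ℕ) : List (List Instr × ℕ × ℕ × ℕ) := (letterPrograms k).map fun b => b.compile (thrWd k) 0 0

/-- The compiler output of one parametric program at `r = φ = 0`, from `1ᵏ`. [folklore] -/
theorem compile_inst_codeFP (pb : PB) : CodeFP unE outBE (fun k => (pb.inst k).compile (thrWd k) 0 0) :=
  ((PB.codeFP pb).comp ((CodeFP.id unE).pair ((const unE 0).pair (const unE 0)))).congr fun _ => rfl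

/-- **The six compiler outputs from `1ᵏ`.** [cite: AroraBarak2009, §1.3] -/
theorem progsOf_codeFP : CodeFP unE (rawE outBE) progsOf := by
  have h : CodeFP unE (rawE outBE) (fun k => letterPBs.map fun pb => (pb.inst k).compile (thrWd k) 0 0) := (
    (rawCons outBE).comp ((compile_inst_codeFP _).pair ((rawCons outBE).comp ((compile_inst_codeFP _).pair
      ((rawCons outBE).comp ((compile_inst_codeFP _).pair ((rawCons outBE).comp ((compile_inst_codeFP _).pair
        ((rawCons outBE).comp ((compile_inst_codeFP _).pair ((rawSingleton outBE).comp (compile_inst_codeFP _))))))))))) :)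
  exact h.congr fun k => by rw [progsOf, ← letterPBs_inst, List.map_map]; rfl

/-- `lmax` of a map is a `foldr`. [folklore] -/
theorem lmax_map {α : Type} (f : α → ℕ) (l : List α) : BlockKit.lmax (l.map f) = l.foldr (fun a m => max (f a) m) 0 := by
  induction l with
  | nil => rfl
  | cons a l ih => rw [List.map_cons, BlockKit.lmax, List.foldr_cons, List.foldr_cons, ← ih]; rfl

/-- A `foldr` of maxima over the six outputs, from `1ᵏ`. [folklore] -/
theorem foldrMax_codeFP {f : List Instr × ℕ × ℕ × ℕ → ℕ} (hf : CodeFP outBE unE f) :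
    CodeFP unE unE (fun k => (letterPBs.map fun pb => (pb.inst k).compile (thrWd k) 0 0).foldr (fun c m => max (f c) m) 0) := by
  have hm : ∀ pb : PB, ∀ {g : ℕ → ℕ}, CodeFP unE unE g → CodeFP unE unE (fun k => max (f ((pb.inst k).compile (thrWd k) 0 0)) (g k)) :=
    fun pb g hg => unMax.comp ((hf.comp (compile_inst_codeFP pb)).pair hg)
  exact hm _ (hm _ (hm _ (hm _ (hm _ (hm _ (const unE 0))))))

/-- **`1ᵏ ↦ 1^{kitR k}`.** [folklore] -/
theorem kitR_codeFP : CodeFP unE unE BlockKit.kitR :=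
  (foldrMax_codeFP (snd _ _).snd'.fst').congr fun k => by unfold BlockKit.kitR; rw [lmax_map, ← letterPBs_inst, List.foldr_map, List.foldr_map]

/-- **`1ᵏ ↦ 1^{kitF k}`.** [folklore] -/
theorem kitF_codeFP : CodeFP unE unE BlockKit.kitF :=
  (foldrMax_codeFP (snd _ _).snd'.snd').congr fun k => by unfold BlockKit.kitF; rw [lmax_map, ← letterPBs_inst, List.foldr_map, List.foldr_map]

/-- **`1ᵏ ↦ 1^{kitT k}`.** [folklore] -/
theorem kitT_codeFP : CodeFP unE unE BlockKit.kitT :=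
  (foldrMax_codeFP ((ulength instrE).comp (fst _ _))).congr fun k => by unfold BlockKit.kitT; rw [lmax_map, ← letterPBs_inst, List.foldr_map, List.foldr_map]

end AJLCore

end Literature.Computability.QuantumComplexity

end
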